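import Literature.Geometry.Riemannian.MeanConvexNormComp
import Mathlib.Analysis.Normed.Operator.Prod

/-!
# The Hessian of a profile function of Fermi data: `F' = Φ(‖Y‖, t)`

Topic `Geometry/Riemannian` (fact seat
`provefact-Literature.Geometry.Riemannian.LawsonMichelsohn1984_surrounding`).  Everything here
is **proved**; no definitions.

In the surrounding construction the junction hypersurface near the attaching sphere `S` is the
zero set of `F'(x) = Φ(‖Y x‖, t x)` for a planar profile `Φ : ℝ × ℝ → ℝ`
(`MeanConvexProfile.lean`) and the *Fermi data* of `S`: a function `t` with `Σ = {t = 0}` and a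
map `Y` onto the normal directions of the core disc (`Δ̂ = {Y = 0}`).  This file expands the
Hessian of such a composite by the second-order chain rule (`MeanConvexSecondChainRule.lean`) and
the Hessian of `‖Y‖` (`MeanConvexNormComp.lean`): at a point `x` with `y = Y x ≠ 0`, `r = ‖y‖`,
`ŷ = r⁻¹ y`, writing `a(v) = ⟨ŷ, DY v⟩`, `b(v) = dt v`,

* `fderiv_fderiv_prodMk_apply` — second derivatives of a pair are pairs of second derivatives;
* `fderiv_fderiv_fermiFun_apply` —
  `D²F'(x)(v, w) = D²Φ(r, t x)((a v, b v), (a w, b w))`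
  `+ ∂ᵣΦ · [(⟨DY v, DY w⟩ - a(v) a(w))/r + ⟨ŷ, D²Y(x)(v, w)⟩] + ∂ₜΦ · D²t(x)(v, w)`,
  the flat-model terms (`MeanConvexGraphHessian.lean`, with `DY`, `dt` in place of the orthogonal
  projection and `⟨e, ·⟩`) plus the curvature terms `∂ᵣΦ ⟨ŷ, D²Y⟩` and `∂ₜΦ D²t` of the data.

## References

* H. B. Lawson, Jr., M.-L. Michelsohn, *Embedding and surrounding with positive mean curvature*,
  Invent. Math. 77 (1984), §3. [LawsonMichelsohn1984]
-/

noncomputable section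

open Set Function Filter
open scoped Topology RealInnerProductSpace

namespace Literature.Geometry.Riemannian

variable {E F G₁ G₂ : Type*} [NormedAddCommGroup E] [NormedSpace ℝ E] [NormedAddCommGroup F]
  [InnerProductSpace ℝ F] [NormedAddCommGroup G₁] [NormedSpace ℝ G₁] [NormedAddCommGroup G₂]
  [NormedSpace ℝ G₂]

/-- **Second derivatives of a pair are pairs of second derivatives**: for `f`, `g` of class `C²`
at `x`, `D²(f, g)(x)(v, w) = (D²f(x)(v, w), D²g(x)(v, w))`. [folklore] -/
theorem fderiv_fderiv_prodMk_apply {f : E → G₁} {g : E → G₂} {x : E} (hf : ContDiffAt ℝ 2 f x)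
    (hg : ContDiffAt ℝ 2 g x) (v w : E) :
    fderiv ℝ (fun z => fderiv ℝ (fun z => (f z, g z)) z) x v w =
      (fderiv ℝ (fun z => fderiv ℝ f z) x v w, fderiv ℝ (fun z => fderiv ℝ g z) x v w) := by
  -- near `x`, `D(f, g) = (Df).prod (Dg)`
  have h1 : ∀ᶠ z in 𝓝 x, ContDiffAt ℝ 2 f z := hf.eventually (by simp)
  have h2 : ∀ᶠ z in 𝓝 x, ContDiffAt ℝ 2 g z := hg.eventually (by simp)
  have hev : (fun z => fderiv ℝ (fun z => (f z, g z)) z) =ᶠ[𝓝 x]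
      fun z => (fderiv ℝ f z).prod (fderiv ℝ g z) := by
    filter_upwards [h1, h2] with z hfz hgz
    exact (hfz.differentiableAt (by simp)).fderiv_prodMk (hgz.differentiableAt (by simp))
  -- differentiate `z ↦ (Df z).prod (Dg z) = prodₗᵢ (Df z, Dg z)`
  have hdf : HasFDerivAt (fun z => fderiv ℝ f z) (fderiv ℝ (fun z => fderiv ℝ f z) x) x :=
    ((hf.fderiv_right (m := 1) le_rfl).differentiableAt one_ne_zero).hasFDerivAt
  have hdg : HasFDerivAt (fun z => fderiv ℝ g z) (fderiv ℝ (fun z => fderiv ℝ g z) x) x :=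
    ((hg.fderiv_right (m := 1) le_rfl).differentiableAt one_ne_zero).hasFDerivAt
  set L : (E →L[ℝ] G₁) × (E →L[ℝ] G₂) →L[ℝ] E →L[ℝ] G₁ × G₂ :=
    ((ContinuousLinearMap.prodₗᵢ ℝ :
      ((E →L[ℝ] G₁) × (E →L[ℝ] G₂)) ≃ₗᵢ[ℝ] (E →L[ℝ] G₁ × G₂)).toContinuousLinearEquiv :
        (E →L[ℝ] G₁) × (E →L[ℝ] G₂) →L[ℝ] E →L[ℝ] G₁ × G₂) with hL
  have hLapply : ∀ q : (E →L[ℝ] G₁) × (E →L[ℝ] G₂), L q = q.1.prod q.2 := fun q => rfl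
  have hL' : HasFDerivAt (fun z => (fderiv ℝ f z).prod (fderiv ℝ g z))
      (L.comp ((fderiv ℝ (fun z => fderiv ℝ f z) x).prod (fderiv ℝ (fun z => fderiv ℝ g z) x))) x := by
    have h := L.hasFDerivAt.comp x (hdf.prodMk hdg)
    exact h
  have hmain := hL'.congr_of_eventuallyEq hev
  rw [hmain.fderiv, ContinuousLinearMap.comp_apply, hLapply]
  rfl

/-- **The Hessian of a profile function of Fermi data.**  Let `Φ : ℝ × ℝ → ℝ` be `C²` at
`(‖Y x‖, t x)`, `Y : E → F` and `t : E → ℝ` of class `C²` at `x`, `Y x ≠ 0`; put `r = ‖Y x‖`,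
`ŷ = r⁻¹ Y x`, `a(v) = ⟨ŷ, DY(x) v⟩`, `b(v) = dt(x) v`, `∂ᵣΦ = DΦ(1, 0)`, `∂ₜΦ = DΦ(0, 1)`.  Then
`D²(Φ ∘ (‖Y‖, t))(x)(v, w) = D²Φ((a v, b v), (a w, b w))`
`+ ∂ᵣΦ ((⟨DY v, DY w⟩ - a(v) a(w))/r + ⟨ŷ, D²Y(v, w)⟩) + ∂ₜΦ D²t(v, w)`.
[cite: LawsonMichelsohn1984, §3] -/
theorem fderiv_fderiv_fermiFun_apply {Φ : ℝ × ℝ → ℝ} {Y : E → F} {t : E → ℝ} {x : E}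
    (hY : ContDiffAt ℝ 2 Y x) (ht : ContDiffAt ℝ 2 t x) (hx : Y x ≠ 0)
    (hΦ : ContDiffAt ℝ 2 Φ (‖Y x‖, t x)) (v w : E) :
    fderiv ℝ (fun z => fderiv ℝ (fun z => Φ (‖Y z‖, t z)) z) x v w =
      fderiv ℝ (fderiv ℝ Φ) (‖Y x‖, t x)
          (⟪‖Y x‖⁻¹ • Y x, fderiv ℝ Y x v⟫, fderiv ℝ t x v)
          (⟪‖Y x‖⁻¹ • Y x, fderiv ℝ Y x w⟫, fderiv ℝ t x w) +
        fderiv ℝ Φ (‖Y x‖, t x) (1, 0) *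
          ((⟪fderiv ℝ Y x v, fderiv ℝ Y x w⟫ -
              ⟪‖Y x‖⁻¹ • Y x, fderiv ℝ Y x v⟫ * ⟪‖Y x‖⁻¹ • Y x, fderiv ℝ Y x w⟫) / ‖Y x‖ +
            ⟪‖Y x‖⁻¹ • Y x, fderiv ℝ (fderiv ℝ Y) x v w⟫) +
        fderiv ℝ Φ (‖Y x‖, t x) (0, 1) * fderiv ℝ (fderiv ℝ t) x v w := by
  -- the inner map `ψ = (‖Y‖, t)` is `C²` at `x`
  have hnY : ContDiffAt ℝ 2 (fun z => ‖Y z‖) x := hY.norm ℝ hx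
  have hψ : ContDiffAt ℝ 2 (fun z => (‖Y z‖, t z)) x := hnY.prodMk ht
  have h := fderiv_fderiv_comp_apply_two (Φ := Φ) (ψ := fun z => (‖Y z‖, t z)) hψ hΦ v w
  have hcomp : (Φ ∘ fun z => (‖Y z‖, t z)) = fun z => Φ (‖Y z‖, t z) := rfl
  rw [hcomp] at h
  rw [h]
  -- first derivative of `ψ`
  have hdψ : ∀ u, fderiv ℝ (fun z => (‖Y z‖, t z)) x u =
      (⟪‖Y x‖⁻¹ • Y x, fderiv ℝ Y x u⟫, fderiv ℝ t x u) := fun u => by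
    rw [(hnY.differentiableAt (by simp)).fderiv_prodMk (ht.differentiableAt (by simp))]
    simp only [ContinuousLinearMap.prod_apply, fderiv_norm_comp_apply (hY.differentiableAt (by simp)) hx]
  -- second derivative of `ψ`
  have hd2ψ : fderiv ℝ (fderiv ℝ fun z => (‖Y z‖, t z)) x v w =
      ((⟪fderiv ℝ Y x v, fderiv ℝ Y x w⟫ -
            ⟪‖Y x‖⁻¹ • Y x, fderiv ℝ Y x v⟫ * ⟪‖Y x‖⁻¹ • Y x, fderiv ℝ Y x w⟫) / ‖Y x‖ +
          ⟪‖Y x‖⁻¹ • Y x, fderiv ℝ (fderiv ℝ Y) x v w⟫,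
        fderiv ℝ (fderiv ℝ t) x v w) := by
    have := fderiv_fderiv_prodMk_apply hnY ht v w
    rw [fderiv_fderiv_norm_comp_apply hY hx] at this
    exact this
  rw [hdψ, hdψ, hd2ψ]
  -- `DΦ (c, d) = c ∂ᵣΦ + d ∂ₜΦ`
  set c : ℝ := (⟪fderiv ℝ Y x v, fderiv ℝ Y x w⟫ -
      ⟪‖Y x‖⁻¹ • Y x, fderiv ℝ Y x v⟫ * ⟪‖Y x‖⁻¹ • Y x, fderiv ℝ Y x w⟫) / ‖Y x‖ +
    ⟪‖Y x‖⁻¹ • Y x, fderiv ℝ (fderiv ℝ Y) x v w⟫ with hc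
  set d : ℝ := fderiv ℝ (fderiv ℝ t) x v w with hd
  have hlin : fderiv ℝ Φ (‖Y x‖, t x) (c, d) =
      fderiv ℝ Φ (‖Y x‖, t x) (1, 0) * c + fderiv ℝ Φ (‖Y x‖, t x) (0, 1) * d := by
    have : ((c, d) : ℝ × ℝ) = c • ((1 : ℝ), (0 : ℝ)) + d • ((0 : ℝ), (1 : ℝ)) := by
      ext <;> simp
    rw [this, map_add, map_smul, map_smul, smul_eq_mul, smul_eq_mul]
    ring
  rw [hlin]
  ring

end Literature.Geometry.Riemannian

end
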